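import Summits.CriticalPhenomena.PercolationContinuityZ3.Theorems.Transplant.PlanarSkeletonFrmFromDefs
import Summits.CriticalPhenomena.PercolationContinuityZ3.Theorems.Transplant.SkelFrmFromBParamsCorrKG0
import Summits.CriticalPhenomena.PercolationContinuityZ3.Theorems.Transplant.SkelFrmBParamsCorrKG0
import HarnessLib
import Summits.CriticalPhenomena.PercolationContinuityZ3.Theorems.Transplant.SkelFrmBParamsCorrKGLen
/-!
# U-WAVE PORT (RULING D-U, lead g21 2026-08-26; WAVE-U-MANIFEST v3.1 row «SkelFrmBParamsCorrKGLen» ↦ «SkelFrmFromBParamsCorrKGLen») of the tree module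
# `Transplant/SkelFrmBParamsCorrKGLen` onto the carrier `PlanarSkeletonFrmFrom` (frames only, cylinders connected from width `ℓ₀` on)

ORIGINAL TITLE: N2 (frames-only node `SamePDropOfSkeletonFrmFrom₁`, OPEN) — (ζ″) ledger, THE K-G CORRIDOR'S LENGTH BUDGET: closed bounds on p5-g16's step counts

builds on p205010 (kernel theorem, internal audit signed; external expert review pending) — nothing in this file uses p205010; NOTHING is claimed about the
OPEN node U `SamePDropOfSkeletonFrmFrom₁` (nor U_s / the end state).  Lane `prim-bschramm`, seat `prim-bschramm-stmt` gen 26 (port pen, RULING M-11 family P-stmt; tool = p3-g26's port_u.py of record, registry-driven inputs); helper file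
(`--supports stmt-CriticalPhenomena-4575 --as helper`).  PORT RULES r1–r4 of RULING D-U: declaration order and proof texts are those of the original,
byte-identical except (i) the carrier token `PlanarSkeletonFrm ↦ PlanarSkeletonFrmFrom` (binders, `namespace`/`end` lines, qualified names of twinned
declarations), (ii) carrier-FREE declarations of the original (φ-level `Skelφ…` blocks and namespace-only arithmetic residents) are NOT re-declared —
this file imports the original and `export`s the twin-free residents (POLICY T / treatment (m1)); residents whose statement mentions a twinned
constant are copied, (iii) every carrier-binding declaration keeps its explicit binder `(Φ : PlanarSkeletonFrmFrom G)` in its own signature (r2).  Docstrings and citations are the original's.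
-/

open scoped Classical

noncomputable section

namespace Summit.CriticalPhenomena.PercolationContinuityZ3.Theorems.Transplant

namespace Skelφ

/-! ## §1 Generic budgets over `KGRows` -/

section Budget

variable {n ℓ : ℕ} {hs v : ℤ} {R' ρ q W : ℕ}

end Budget

end Skelφ

/-! ## §2 At the values of record (`ρ := 0`, SkelFrmBParamsCorrKG0): `h0` and the (R-34) length budget `LfQ` -/

namespace PlanarSkeletonFrmFrom

namespace NegB

open Literature.Probability.Percolation Literature.Probability.LatticeModels SimpleGraph
open SkelConc (Consts)
open Skelφ (shearUnit kgSL kgΔ kgN kgFar kgX₂ kgM₁ kgM₂ KGRows)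
open Neg

section Values

variable (κ : Consts) {V : Type} [DecidableEq V] [Countable V] {G : SimpleGraph V} [G.LocallyFinite] (Φ : PlanarSkeletonFrmFrom G) (t : V) (p : unitInterval)
  (D : Skelφ.StepI.DataNS V) (g f mk qx Wx : ℕ)

/-- **The residual floors** of the corridor tuple: `qx ≤ 40·n_L` and `Wx ≤ 20·sL` (room for the start-box rows `haq/hbW`). [this work] -/
structure KGRes : Prop where
  /-- `qx ≤ 40·n_L` -/
  hqx : qx ≤ 40 * nL κ Φ t p D g f
  /-- `Wx ≤ 20·sL` -/
  hWx : (Wx : ℤ) ≤ 20 * kgSL (nL κ Φ t p D g f) (ℓL κ Φ t p D g f) (hL κ Φ t p D g f)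

/-- The generic floors at the values (`ρ := 0`): `3(2R′+0) ≤ sL`, `3(2R′+0) ≤ n_L`, `4R′+3·0 ≤ n_L`, `8R′ ≤ sL`, and `W ≤ 21·sL` under `Wx ≤ 20·sL`. [folklore] -/
theorem kg_floors (κ : Consts) {V : Type} [DecidableEq V] [Countable V] {G : SimpleGraph V} [G.LocallyFinite] (Φ : PlanarSkeletonFrmFrom G) (t : V) (p : unitInterval) (D : Skelφ.StepI.DataNS V) (g : ℕ) (f : ℕ) (mk : ℕ) (Wx : ℕ) (hN : EqNumL κ Φ t p D g f) (hg : gFloorKG κ Φ t p D mk ≤ g)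
    (hWx : (Wx : ℤ) ≤ 20 * kgSL (nL κ Φ t p D g f) (ℓL κ Φ t p D g f) (hL κ Φ t p D g f)) :
    3 * (2 * ((kgR κ Φ t p D mk : ℕ) : ℤ) + ((0 : ℕ) : ℤ)) ≤ kgSL (nL κ Φ t p D g f) (ℓL κ Φ t p D g f) (hL κ Φ t p D g f) ∧
    3 * (2 * ((kgR κ Φ t p D mk : ℕ) : ℤ) + ((0 : ℕ) : ℤ)) ≤ (nL κ Φ t p D g f : ℤ) ∧
    4 * ((kgR κ Φ t p D mk : ℕ) : ℤ) + 3 * ((0 : ℕ) : ℤ) ≤ (nL κ Φ t p D g f : ℤ) ∧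
    8 * ((kgR κ Φ t p D mk : ℕ) : ℤ) ≤ kgSL (nL κ Φ t p D g f) (ℓL κ Φ t p D g f) (hL κ Φ t p D g f) ∧
    ((kgW κ Φ t p D g f Wx : ℕ) : ℤ) ≤ 21 * kgSL (nL κ Φ t p D g f) (ℓL κ Φ t p D g f) (hL κ Φ t p D g f) := by
  have hnle := hN.n_le
  have hgML : g ≤ ML κ Φ t p D g := (ML_le_ML κ Φ t p D g).2
  have hsL := ML_sub_one_le_kgSL κ Φ t p D g f hN
  unfold gFloorKG at hg
  have hfl : ((8 * KS0.R'0 κ Φ t p D mk + 3 * Mu D + 6 : ℕ) : ℤ) ≤ ML κ Φ t p D g := by exact_mod_cast hg.trans hgML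
  push_cast at hfl
  unfold kgR kgW
  have hs0 : 0 ≤ kgSL (nL κ Φ t p D g f) (ℓL κ Φ t p D g f) (hL κ Φ t p D g f) := by linarith
  have ht : (((kgSL (nL κ Φ t p D g f) (ℓL κ Φ t p D g f) (hL κ Φ t p D g f)).toNat : ℕ) : ℤ) =
      kgSL (nL κ Φ t p D g f) (ℓL κ Φ t p D g f) (hL κ Φ t p D g f) := Int.toNat_of_nonneg hs0
  have hM0 : (0 : ℤ) ≤ (Mu D : ℤ) := by positivity
  push_cast
  rw [ht]
  refine ⟨by linarith, by linarith, by linarith, by linarith, by linarith⟩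

/-- **`h0` DISCHARGED** (`ρ := 0`): the first run step fits, `kgFar … 0 ≤ kgTgt0`, under `EqNumL`, the box-slot floor and the residual floors. [this work] -/
theorem kgFar_zero_le_kgTgt0 (κ : Consts) {V : Type} [DecidableEq V] [Countable V] {G : SimpleGraph V} [G.LocallyFinite] (Φ : PlanarSkeletonFrmFrom G) (t : V) (p : unitInterval) (D : Skelφ.StepI.DataNS V) (g : ℕ) (f : ℕ) (mk : ℕ) (qx : ℕ) (Wx : ℕ) (hN : EqNumL κ Φ t p D g f) (hg : gFloorKG κ Φ t p D mk ≤ g) (hx : KGRes κ Φ t p D g f qx Wx) :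
    kgFar (nL κ Φ t p D g f) (ℓL κ Φ t p D g f) (hL κ Φ t p D g f) (vL κ Φ t p D g f) (kgR κ Φ t p D mk) 0 (kgq κ Φ t p D g f qx)
      (kgW κ Φ t p D g f Wx) 0 ≤ kgTgt0 κ Φ t p D g f mk := by
  have H := kgRows0_of κ Φ t p D g f mk qx Wx hN hg
  obtain ⟨hS, -, hS₂, -, hW2⟩ := kg_floors κ Φ t p D g f mk Wx hN hg hx.hWx
  have hb := H.kgFar_zero_budget hS hS₂ hW2
  have hqx : ((qx : ℕ) : ℤ) ≤ 40 * (nL κ Φ t p D g f : ℤ) := by exact_mod_cast hx.hqx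
  have hv := hN.v_le
  have hK := (Skelφ.NegPrm.forty_le_Kcell κ.K₀).1
  have hK' : (40 : ℤ) ≤ (Neg.K κ : ℤ) := by unfold Neg.K; exact_mod_cast hK
  have hn0 : (0 : ℤ) ≤ nL κ Φ t p D g f := by positivity
  have hpt := (pitch_le_kgTgt0 κ Φ t p D g f mk hN).1
  have hpitch : 800 * (nL κ Φ t p D g f : ℤ) ≤ pitch κ Φ t p D g f := by unfold pitch; nlinarith
  have e1 : ((kgq κ Φ t p D g f qx : ℕ) : ℤ) = 2 * (nL κ Φ t p D g f : ℤ) + qx := by unfold kgq; push_cast; ring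
  push_cast at hb hS₂
  linarith

export PlanarSkeletonFrm.NegB (LfQ)

export PlanarSkeletonFrm.NegB (LfQ_eq)

/-- **THE CORRIDOR FITS THE BUDGET** (`ρ := 0`): `N + 1 + (m₁+1) + (m₂+1) ≤ LfQ κ.K₀` at the values of record (`(kgCorrSched …).N = N + 1 + m₁ + 1 + m₂`,
`kgCorrSched_params`, so this is `S.N + 1 ≤ LfQ`), under `EqNumL`, the box-slot floor and the residual floors. [this work] -/
theorem kgSchedN_le_LfQ (κ : Consts) {V : Type} [DecidableEq V] [Countable V] {G : SimpleGraph V} [G.LocallyFinite] (Φ : PlanarSkeletonFrmFrom G) (t : V) (p : unitInterval) (D : Skelφ.StepI.DataNS V) (g : ℕ) (f : ℕ) (mk : ℕ) (qx : ℕ) (Wx : ℕ) (hN : EqNumL κ Φ t p D g f) (hg : gFloorKG κ Φ t p D mk ≤ g) (hx : KGRes κ Φ t p D g f qx Wx) :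
    kgNv0 κ Φ t p D g f mk qx Wx + 1 +
        (kgM₁ (nL κ Φ t p D g f) (ℓL κ Φ t p D g f) (hL κ Φ t p D g f) (kgR κ Φ t p D mk) 0 (kgW κ Φ t p D g f Wx)
          (kgNv0 κ Φ t p D g f mk qx Wx) + 1) +
        (kgM₂ (nL κ Φ t p D g f) (ℓL κ Φ t p D g f) (hL κ Φ t p D g f) (vL κ Φ t p D g f) (kgR κ Φ t p D mk) 0 (kgq κ Φ t p D g f qx)
          (kgW κ Φ t p D g f Wx) (kgNv0 κ Φ t p D g f mk qx Wx) + 1) ≤ LfQ κ.K₀ := by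
  have H := kgRows0_of κ Φ t p D g f mk qx Wx hN hg
  obtain ⟨hS, hSn, -, hR8, hW2⟩ := kg_floors κ Φ t p D g f mk Wx hN hg hx.hWx
  have hNle := kgNv0_le κ Φ t p D g f mk qx Wx hN hg
  have hK := (Skelφ.NegPrm.forty_le_Kcell κ.K₀).1
  have hK' : (40 : ℤ) ≤ (Neg.K κ : ℤ) := by unfold Neg.K; exact_mod_cast hK
  have hNz : ((kgNv0 κ Φ t p D g f mk qx Wx : ℕ) : ℤ) ≤ 20 * (Neg.K κ : ℤ) + 4 := by exact_mod_cast hNle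
  have hq6 : ((kgq κ Φ t p D g f qx : ℕ) : ℤ) ≤ 42 * (nL κ Φ t p D g f : ℤ) := by
    have hqx : qx ≤ 40 * nL κ Φ t p D g f := hx.hqx
    unfold kgq; push_cast
    have : ((qx : ℕ) : ℤ) ≤ 40 * (nL κ Φ t p D g f : ℤ) := by exact_mod_cast hqx
    linarith
  have hb := H.kgSchedN_budget hS hSn hR8 hW2 hq6 hK' (kgNv0 κ Φ t p D g f mk qx Wx) hNz
  have hZ : ((kgNv0 κ Φ t p D g f mk qx Wx + 1 +
        (kgM₁ (nL κ Φ t p D g f) (ℓL κ Φ t p D g f) (hL κ Φ t p D g f) (kgR κ Φ t p D mk) 0 (kgW κ Φ t p D g f Wx)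
          (kgNv0 κ Φ t p D g f mk qx Wx) + 1) +
        (kgM₂ (nL κ Φ t p D g f) (ℓL κ Φ t p D g f) (hL κ Φ t p D g f) (vL κ Φ t p D g f) (kgR κ Φ t p D mk) 0 (kgq κ Φ t p D g f qx)
          (kgW κ Φ t p D g f Wx) (kgNv0 κ Φ t p D g f mk qx Wx) + 1) : ℕ) : ℤ) ≤ ((LfQ κ.K₀ : ℕ) : ℤ) := by
    rw [LfQ_eq]; push_cast; linarith
  exact_mod_cast hZ

end Values

end NegB

end PlanarSkeletonFrmFrom

end Summit.CriticalPhenomena.PercolationContinuityZ3.Theorems.Transplant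

end
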